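import Literature.Topology.FourManifolds.GluingSmoothing
import HarnessLib

/-!
# Uniqueness of gluings with control away from the seam

Topic `Literature/Topology/FourManifolds`; a complement to `GluingSmoothing.lean` (the proof of
the tree's named fact `Literature.Topology.FourManifolds.nonempty_diffeomorph_of_isBoundaryGluing`,
Hirsch, *Differential Topology* (1976), Ch. 8, Thm. 2.1 with Thm. 1.9; Bröcker–Jänich (1982),
(13.9) with (13.7)).  Everything here is PROVED; no definitions of named facts.

`BoundaryGluingData.nonempty_diffeomorph` only records that two gluings `P`, `P'` of the same
compact Hausdorff pieces `M`, `N` along the same identification `φ : ∂M ≃ ∂N` are diffeomorphic.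
The diffeomorphism constructed there (`ComparisonFrame.Ext.glueDiffeomorph`) is Hirsch's
`f' ∪ f''`: the comparison map `jA a ↦ jA' a`, `jB b ↦ jB' b` corrected *only inside a tube about
the seam* (`ComparisonFrame.Ext.glue_eq_compare`).  Since the tube of the seam-tube datum can be
taken as thin as we please (`SeamTube.restrict`), the correction can be confined to an arbitrary
neighbourhood of the seam.  This file records the resulting **controlled uniqueness of gluings**:

* `BoundaryGluingData.SeamTube.restrict` — a seam tube with a smaller half-width.
* `BoundaryGluingData.exists_pos_le_abs_height` — a compact set off the seam has height bounded
  away from `0`.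
* `BoundaryGluingData.exists_diffeomorph_eq_compare_of_isCompact` — for every compact `S ⊆ P`
  disjoint from the seam there is a diffeomorphism `Ψ : P ≅ P'` which IS the comparison map on
  `S`.
* `BoundaryGluingData.exists_diffeomorph_eq_compare_of_isOpen` — the same for the complement of
  any open neighbourhood of the seam; and the two specialisations
  `exists_diffeomorph_apply_jA_eq` / `exists_diffeomorph_apply_jB_eq` (agreement with `jA' ∘ jA⁻¹`,
  `jB' ∘ jB⁻¹` off a neighbourhood of `∂M`, `∂N` in the pieces).

This is the form in which the uniqueness of gluings is used relative to a boundary or to a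
sub-piece: Milnor, *Lectures on the h-cobordism theorem* (1965), Thm. 1.4 ("unique up to a
diffeomorphism leaving `V₀`, `h(V₁) = V₁′`, and `V₂′` fixed"); Hirsch (1976), Ch. 8 §2, Thm. 2.1
and Ex. 2 (the diffeomorphism can be chosen to be the identity outside a neighbourhood of the
seam).

## References

* M. W. Hirsch, *Differential Topology*, GTM 33 (1976), Ch. 8 §1 Thm. 1.9, §2 Thm. 2.1.
  [HirschDT1976]
* J. Milnor, *Lectures on the h-cobordism theorem*, Princeton (1965), §1, Thm. 1.4.
  [MilnorHCobordism1965]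
* Th. Bröcker, K. Jänich, *Introduction to Differential Topology* (1982), (13.7), (13.9).
  [BrockerJanich1982]
-/

open scoped Manifold ContDiff Topology
open Set Function Filter Topology

noncomputable section

namespace Literature.Topology.FourManifolds

universe u v w

/-- Local notation: `𝔼 n` is the model Euclidean space `EuclideanSpace ℝ (Fin n)`. -/
local notation "𝔼 " n:arg => EuclideanSpace ℝ (Fin n)
/-- Local notation: `ℍ n` is the closed half space `EuclideanHalfSpace n`. -/
local notation "ℍ " n:arg => EuclideanHalfSpace n

namespace BoundaryGluingData

variable {n : ℕ} {M N : Type u} [TopologicalSpace M] [ChartedSpace (ℍ (n + 1)) M]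
  [TopologicalSpace N] [ChartedSpace (ℍ (n + 1)) N]
  {bM : BoundaryData (𝓡∂ (n + 1)) M (𝓡 n)} {bN : BoundaryData (𝓡∂ (n + 1)) N (𝓡 n)}
  {φ : bM.carrier ≃ bN.carrier}
  {P : Type v} [TopologicalSpace P] [ChartedSpace (𝔼 (n + 1)) P]
  {P' : Type w} [TopologicalSpace P'] [ChartedSpace (𝔼 (n + 1)) P']

/-! ### Thin seam tubes -/

namespace SeamTube

variable {G : BoundaryGluingData bM bN φ P} (T : G.SeamTube)

/-- **Shrinking the half-width of a seam tube.** The same tube map, inverse and height, with the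
half-width `ε` replaced by any `ε' ∈ (0, ε]`; all axioms restrict. [folklore] -/
def restrict (ε' : ℝ) (hε' : 0 < ε') (hle : ε' ≤ T.ε) : G.SeamTube where
  toFun := T.toFun
  invFun := T.invFun
  height := T.height
  ε := ε'
  ε_pos := hε'
  contMDiff_toFun := T.contMDiff_toFun
  contMDiff_height := T.contMDiff_height
  contMDiffOn_invFun :=
    T.contMDiffOn_invFun.mono (preimage_mono (Ioo_subset_Ioo (neg_le_neg hle) hle))
  toFun_zero := T.toFun_zero
  height_toFun x t ht := T.height_toFun x t (Ioo_subset_Ioo (neg_le_neg hle) hle ht)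
  invFun_toFun x t ht := T.invFun_toFun x t (Ioo_subset_Ioo (neg_le_neg hle) hle ht)
  toFun_invFun p hp := T.toFun_invFun p (Ioo_subset_Ioo (neg_le_neg hle) hle hp)
  invFun_snd := T.invFun_snd
  height_eq_zero_iff := T.height_eq_zero_iff
  height_pos_iff := T.height_pos_iff
  height_neg_iff := T.height_neg_iff

/-- The restricted tube has the prescribed half-width (definitional). [folklore] -/
@[simp] theorem restrict_ε (ε' : ℝ) (hε' : 0 < ε') (hle : ε' ≤ T.ε) :
    (T.restrict ε' hε' hle).ε = ε' := rfl

/-- The restricted tube has the same height function (definitional). [folklore] -/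
@[simp] theorem restrict_height (ε' : ℝ) (hε' : 0 < ε') (hle : ε' ≤ T.ε) :
    (T.restrict ε' hε' hle).height = T.height := rfl

/-- **A compact set off the seam has height bounded away from zero.** [folklore] -/
theorem exists_pos_le_abs_height {S : Set P} (hS : IsCompact S) (hSs : Disjoint S G.seam) :
    ∃ b > 0, ∀ p ∈ S, b ≤ |T.height p| := by
  rcases S.eq_empty_or_nonempty with rfl | hne
  · exact ⟨1, one_pos, fun p hp => hp.elim⟩
  have hcont : Continuous fun p : P => |T.height p| :=
    continuous_abs.comp T.contMDiff_height.continuous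
  obtain ⟨p₀, hp₀, hmin⟩ := hS.exists_isMinOn hne hcont.continuousOn
  refine ⟨|T.height p₀|, abs_pos.2 fun h0 => ?_, fun p hp => isMinOn_iff.1 hmin p hp⟩
  exact Set.disjoint_left.1 hSs hp₀ ((T.height_eq_zero_iff _).1 h0)

end SeamTube

/-! ### Controlled uniqueness -/

section Controlled

variable [T2Space M] [T2Space N] [CompactSpace M] [CompactSpace N]
  [IsManifold (𝓡∂ (n + 1)) ∞ M] [IsManifold (𝓡∂ (n + 1)) ∞ N] [IsManifold (𝓡 (n + 1)) ∞ P]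
  [IsManifold (𝓡 (n + 1)) ∞ P']

/-- **Uniqueness of gluings, controlled off the seam (Hirsch, Ch. 8, Thm. 2.1; Milnor (1965),
Thm. 1.4).** Let `G`, `G'` be gluing data of the same compact Hausdorff pieces `M`, `N` along the
same identification of the boundaries, over `P` and `P'`, and let `S ⊆ P` be a compact set
disjoint from the seam `jA (∂M)`.  Then there is a diffeomorphism `Ψ : P ≅ P'` which agrees ON
`S` with the comparison map `jA a ↦ jA' a`, `jB b ↦ jB' b`.  Proof: run the smoothing of
`GluingSmoothing.lean` with the seam tube of `G` restricted to a half-width `≤ min |height| (S)`;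
the smoothing differs from the comparison map only where `|height| < a₁ <` half-width.
[cite: HirschDT1976, Ch. 8 §2, Thm. 2.1] -/
theorem exists_diffeomorph_eq_compare_of_isCompact (G : BoundaryGluingData bM bN φ P)
    (G' : BoundaryGluingData bM bN φ P') {S : Set P} (hS : IsCompact S)
    (hSs : Disjoint S G.seam) :
    ∃ Ψ : P ≃ₘ⟮𝓡 (n + 1), 𝓡 (n + 1)⟯ P', ∀ p ∈ S, Ψ p = G.compare G' p := by
  rcases isEmpty_or_nonempty bM.carrier with hE | hE
  · exact ⟨compareDiffeomorphOfIsEmpty G G', fun p _ => rfl⟩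
  · set T₀ := G.seamTube with hT₀
    obtain ⟨b, hb, hbS⟩ := T₀.exists_pos_le_abs_height hS hSs
    set T := T₀.restrict (min b T₀.ε) (lt_min hb T₀.ε_pos) (min_le_right _ _) with hT
    set T' := G'.seamTube with hT'
    obtain ⟨Fr⟩ := exists_comparisonFrame T T'
    obtain ⟨E⟩ := Fr.nonempty_ext
    refine ⟨E.glueDiffeomorph, fun p hp => E.glue_eq_compare ?_⟩
    have h1 : E.a₁ < min b T₀.ε := E.a₁_lt.trans_le Fr.δ_le
    have h2 : min b T₀.ε ≤ |T₀.height p| := (min_le_left _ _).trans (hbS p hp)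
    exact (h1.trans_le h2).le

/-- **Uniqueness of gluings, the identity outside a neighbourhood of the seam.** For every open
`U ⊇ jA (∂M)` there is a diffeomorphism `Ψ : P ≅ P'` which agrees with the comparison map off `U`
(the gluing of compact pieces is compact, so `P - U` is a compact set off the seam).
[cite: HirschDT1976, Ch. 8 §2, Thm. 2.1] -/
theorem exists_diffeomorph_eq_compare_of_isOpen (G : BoundaryGluingData bM bN φ P)
    (G' : BoundaryGluingData bM bN φ P') {U : Set P} (hU : IsOpen U) (hUs : G.seam ⊆ U) :
    ∃ Ψ : P ≃ₘ⟮𝓡 (n + 1), 𝓡 (n + 1)⟯ P', ∀ p, p ∉ U → Ψ p = G.compare G' p := by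
  haveI := G.compactSpace
  obtain ⟨Ψ, hΨ⟩ := G.exists_diffeomorph_eq_compare_of_isCompact G' hU.isClosed_compl.isCompact
    (Set.disjoint_left.2 fun p hp hs => hp (hUs hs))
  exact ⟨Ψ, fun p hp => hΨ p hp⟩

/-- **The controlled diffeomorphism on the first piece**: off any open neighbourhood `O` of `∂M`
in `M`, `Ψ ∘ jA = jA'`. [cite: HirschDT1976, Ch. 8 §2, Thm. 2.1] -/
theorem exists_diffeomorph_apply_jA_eq (G : BoundaryGluingData bM bN φ P)
    (G' : BoundaryGluingData bM bN φ P') {O : Set M} (hO : IsOpen O) (hOb : range bM.incl ⊆ O)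
    {O' : Set N} (hO' : IsOpen O') (hOb' : range bN.incl ⊆ O') :
    ∃ Ψ : P ≃ₘ⟮𝓡 (n + 1), 𝓡 (n + 1)⟯ P',
      (∀ a, a ∉ O → Ψ (G.jA a) = G'.jA a) ∧ (∀ b, b ∉ O' → Ψ (G.jB b) = G'.jB b) := by
  -- the compact set `jA (M - O) ∪ jB (N - O')` misses the seam
  have hK : IsCompact (G.jA '' Oᶜ ∪ G.jB '' O'ᶜ) :=
    ((hO.isClosed_compl.isCompact).image G.continuous_jA).union
      ((hO'.isClosed_compl.isCompact).image G.continuous_jB)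
  have hKs : Disjoint (G.jA '' Oᶜ ∪ G.jB '' O'ᶜ) G.seam := by
    refine Set.disjoint_left.2 ?_
    rintro p (⟨a, ha, rfl⟩ | ⟨b, hb, rfl⟩) hs
    · rw [G.jA_mem_seam_iff] at hs
      exact ha (hOb hs)
    · obtain ⟨z, hz⟩ := hs
      have hz' : G.jB (bN.incl (φ z)) = G.jB b := by rw [← G.jA_incl]; exact hz
      exact hb (hOb' ⟨φ z, G.injective_jB hz'⟩)
  obtain ⟨Ψ, hΨ⟩ := G.exists_diffeomorph_eq_compare_of_isCompact G' hK hKs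
  refine ⟨Ψ, fun a ha => ?_, fun b hb => ?_⟩
  · rw [hΨ _ (Or.inl ⟨a, ha, rfl⟩), compare_jA]
  · rw [hΨ _ (Or.inr ⟨b, hb, rfl⟩), compare_jB]

end Controlled

end BoundaryGluingData

end Literature.Topology.FourManifolds

end
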